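import Summits.BirchSwinnertonDyer.BirchSwinnertonDyer.Theorems.GenusKolyvaginAtTwoGenusPrimitiveSupplyAtTwoOfKernels
import Summits.BirchSwinnertonDyer.BirchSwinnertonDyer.Theorems.GenusKolyvaginAtTwoGenusPrimitiveSupplyAtTwoTwinConverseEll
import Summits.BirchSwinnertonDyer.BirchSwinnertonDyer.Theorems.GenusKolyvaginAtTwoGenusPrimitiveSupplyAtTwoTwinSupplyEll
import Summits.BirchSwinnertonDyer.BirchSwinnertonDyer.Theorems.GenusKolyvaginAtTwoGenusPrimitiveSupplyAtTwoOfExactComponent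
import HarnessLib

/-!
# R-128 retype — print-form twins of `GenusKolyvaginAtTwoGenusPrimitiveSupplyAtTwoOfKernels`

Seat `bsd-line-gk2-p2` g21 (cell `bsd-f1-sign2`), route `GenusKolyvaginAtTwo`, `--supports stmt-BirchSwinnertonDyer-22136`
(helper; closes nothing). Director-bsd R-128 RETYPE ORDER (2026-08-29 17:42Z; bsd-cited U-r05-BX, T-Q381-1′): the theorems
`genusPrimitiveSupplyAtTwo_of_kernels'`, `genusPrimitiveSupplyAtTwo_of_twoConverse_of_multiGenus'`, `genusPrimitiveSupplyAtTwo_of_namedFacts_of_twoConverse_of_multiGenus'`, 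
of `Summits.BirchSwinnertonDyer.BirchSwinnertonDyer.Theorems.GenusKolyvaginAtTwoGenusPrimitiveSupplyAtTwoOfKernels` take the BARE closure
`∀ V : WeierstrassCurve ℚ, p_parity V 2` (all Weierstrass cubics, singular included — off print and undischargeable by any
faithful Dokchitser–Dokchitser discharge). This file declares their PRIMED TWINS with the hypothesis in print form
`∀ (V : WeierstrassCurve ℚ) [V.IsElliptic], p_parity V 2` (= route item `TwoParityDD` since rev 34); statements and proofs are
otherwise identical (every application `hpar W` is at an elliptic curve), calls to other retyped theorems go to their twins.
The tree is append-only, so the originals stay (superseded); the file is over the 400-line budget of the original, hence separate.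
THEOREMS ONLY; no definition, no named fact, no `sorry`. BSD is NOT proved by any of this; nothing is closed.
-/

set_option linter.dupNamespace false -- tree convention: `Summit.BirchSwinnertonDyer.BirchSwinnertonDyer.Theorems` (summit = sub-problem)

noncomputable section

open scoped Classical

namespace Summit.BirchSwinnertonDyer.BirchSwinnertonDyer.Theorems.GenusKoly

open Finset NumberField WeierstrassCurve Literature.NumberTheory.EllipticCurves
  Literature.NumberTheory.EllipticCurves.ModularForms

/-! ## R-128 retype (director-bsd 2026-08-29 17:42Z, T-Q381-1′; seat bsd-line-gk2-p2 g21): PRINT-FORM TWINS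
Every theorem below is the byte-identical twin of the theorem of the same name without the trailing prime, with the ONE change
that the `2`-parity hypothesis is typed as print has it — `∀ (V : WeierstrassCurve ℚ) [V.IsElliptic], p_parity V 2`
(Dokchitser–Dokchitser 2010 Thm. 1.4, elliptic curves; = route item `TwoParityDD` after rev 34) — instead of the bare closure
`∀ V : WeierstrassCurve ℚ, p_parity V 2` over all Weierstrass cubics (singular ones included: off print, undischargeable).
Calls to other retyped theorems go to their primed twins; every application `hpar W` is at an elliptic curve, so the proofs are
unchanged. The unprimed originals are kept (append-only tree) and are superseded by these. BSD is NOT proved by any of this. -/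


/-- **R-128 retype** (director-bsd 2026-08-29, T-Q381-1′) of `genusPrimitiveSupplyAtTwo_of_kernels`: the SAME statement and proof with the `2`-parity hypothesis in PRINT form `∀ (V : WeierstrassCurve ℚ) [V.IsElliptic], p_parity V 2` (Dokchitser–Dokchitser 2010 Thm. 1.4 is about elliptic curves; the bare closure over all Weierstrass cubics was off print). **THE CRUX `GenusPrimitiveSupplyAtTwo` BY NAME FROM ITS THREE OPEN KERNELS, modulo published facts.** Modularity ∧ `2`-parity
∧ entire `L`-functions ∧ Gross–Zagier ∧ (CONV₂) ∧ (SUPPLY) ∧ (U) ⟹ `Theses.GenusKolyvaginAtTwo.GenusPrimitiveSupplyAtTwo`. The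
three non-published hypotheses are spelled out in binders: (CONV₂) `∀ V non-CM globally minimal, corank_{ℤ₂} Sel_{2^∞}(V/ℚ) = 1 →
r_an(V) = 1`; (SUPPLY) in the frame of stub A without its analytic clause; (U) in the frame of stub C with the multi-genus trace
in place of `P(n)`. CONDITIONAL; the crux is OPEN exactly at (CONV₂) ∧ (SUPPLY) ∧ (U). BSD is not proved by any of this.
[cite: GrossLMS1991, §3 (3.5), Prop. 3.7 (1), §4 (4.1)] [cite: GrossZagier1986, Thm. I.6.3] [cite: DokchitserDokchitserAnnals2010, Thm. 1.4]
[cite: McCallumLMS1991, §5 Lemma 5.1] -/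
theorem genusPrimitiveSupplyAtTwo_of_kernels' (hmod : exists_isNewformOf)
    (hpar : ∀ (V : WeierstrassCurve ℚ) [V.IsElliptic], p_parity V 2) (hE : hasEntireLFunction_rat)
    (hGZ : ∀ (W : WeierstrassCurve ℚ) [NeZero (W.conductorNorm ℤ)] (K : Type) [Field K] [NumberField K],
      gross_zagier (W.conductorNorm ℤ) W K)
    (hconv : ∀ (V : WeierstrassCurve ℚ) [V.IsElliptic] [V.IsGloballyMinimal],
      ¬ V.HasCM → V.selmerCorank 2 = 1 → V.analyticRank = 1)
    (hsupply : ∀ (W : WeierstrassCurve ℚ) [W.IsElliptic] [W.IsGloballyMinimal] [NeZero (W.conductorNorm ℤ)],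
      ¬ W.HasCM → W.analyticRank = 0 → (∀ n : ℕ, 0 < n → W.HasSurjectiveModNGaloisRep ((2 : ℤ) ^ n)) →
      ∃ (K : Type) (_ : Field K) (_ : NumberField K),
        IsImaginaryQuadratic K ∧ Odd (NumberField.discr K) ∧ NumberField.discr K ≠ -3 ∧
        SatisfiesHeegnerHypothesis (W.conductorNorm ℤ) K ∧
        ¬ IsSquare ((NumberField.discr K : ℚ) * -|W.Δ|) ∧ ¬ IsSquare ((NumberField.discr K : ℚ) * (-(2 * |W.Δ|))) ∧
        ∃ (Wd : WeierstrassCurve ℚ) (_ : Wd.IsElliptic) (_ : Wd.IsGloballyMinimal),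
          (∃ C : WeierstrassCurve.VariableChange ℚ, C • W.quadraticTwist (NumberField.discr K : ℚ) = Wd) ∧
          Nat.card (Wd.selmerGroup 2) = 2)
    (hU : ∀ (W : WeierstrassCurve ℚ) [W.IsElliptic] [W.IsGloballyMinimal] [NeZero (W.conductorNorm ℤ)],
      ¬ W.HasCM → W.analyticRank = 0 → (∀ n : ℕ, 0 < n → W.HasSurjectiveModNGaloisRep ((2 : ℤ) ^ n)) →
      Odd W.tamagawaProduct →
      ∀ (K : Type) [Field K] [NumberField K],
      IsImaginaryQuadratic K → Odd (NumberField.discr K) → NumberField.discr K ≠ -3 →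
      SatisfiesHeegnerHypothesis (W.conductorNorm ℤ) K →
      ¬ IsSquare ((NumberField.discr K : ℚ) * -|W.Δ|) → ¬ IsSquare ((NumberField.discr K : ℚ) * (-(2 * |W.Δ|))) →
      ∀ (Dt : ModularParametrizationData W (W.conductorNorm ℤ)),
      (∀ z ∈ Dt.L.lattice, ∃ w ∈ periodLattice Dt.f, z = (Dt.c : ℂ) * w) → Odd Dt.c →
      ∀ (β : ℤ) (ι : K →+* ℂ) (d₁ : KolyvaginHeegnerData Dt β ι 1), ¬ IsOfFinAddOrder d₁.derivedPoint →
      ∀ (Wd : WeierstrassCurve ℚ) [Wd.IsElliptic] [Wd.IsGloballyMinimal],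
      (∃ C : WeierstrassCurve.VariableChange ℚ, C • W.quadraticTwist (NumberField.discr K : ℚ) = Wd) →
      Wd.analyticRank = 1 → Nat.card (Wd.selmerGroup 2) = 2 →
      ∃ (n : ℕ) (d : KolyvaginHeegnerData Dt β ι n) (θ : ℕ → ringClassField K ι n)
        (T : Finset (ringClassField K ι n ≃ₐ[ℚ] ringClassField K ι n)), Squarefree n ∧
        (∀ ℓ ∈ n.primeFactors, Zhang2014.IsKolyvaginPrime (W.conductorNorm ℤ) W K 2 ℓ) ∧
        (∀ ℓ ∈ n.primeFactors, θ ℓ ^ 2 = algebraMap ℚ (ringClassField K ι n) ((-1 : ℚ) ^ (ℓ / 2) * ℓ)) ∧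
        (∀ g, g ∈ T ↔ g ∈ ringClassGal ι n ∧ ∀ ℓ ∈ n.primeFactors, g (θ ℓ) = θ ℓ) ∧
        ¬ ∃ Q : (W.baseChange (ringClassField K ι n)).toAffine.Point, (2 : ℤ) • Q =
          ∑ g ∈ T, pointGalHom W (ringClassField K ι n) g d.y) :
    Summit.BirchSwinnertonDyer.BirchSwinnertonDyer.Theses.GenusKolyvaginAtTwo.GenusPrimitiveSupplyAtTwo := by
  intro W _ _ _ hcm hr0 hρ hT hopt
  -- A = SUPPLY + CONV₂
  obtain ⟨K, iF, iN, hIQ, hodd, h3, hHe, hsq1, hsq2, Wd, iE, iM, hWd, hrd, hSel⟩ :=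
    stub_minimalTwinSupplyAtTwo_of_twoConverse' hmod hpar hconv hsupply W hcm hr0 hρ
  obtain ⟨Dt, hoptDt, hc⟩ := hopt
  -- glue: orientation, embedding, conductor-`1` datum
  obtain ⟨β, hβ⟩ : ∃ β : ℤ, (4 * (W.conductorNorm ℤ : ℕ) : ℤ) ∣ β ^ 2 - NumberField.discr K :=
    Literature.NumberTheory.QuadraticFields.Quadratic.exists_dvd_sq_sub_discr_of_ncard_primesOver hIQ.1 (NeZero.ne _) hHe
  obtain ⟨ι⟩ : Nonempty (K →+* ℂ) := inferInstance
  obtain ⟨d₁⟩ := exists_kolyvaginHeegnerData_one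
    (phi_heegnerTau_mem_singularModuliField_holds (W.conductorNorm ℤ) W K) hIQ Dt β ι hβ
  -- the twin: non-CM, analytic rank of the twist read off the minimal model
  have hd : (NumberField.discr K : ℚ) ≠ 0 := by exact_mod_cast NumberField.discr_ne_zero K
  haveI := W.isElliptic_quadraticTwist hd
  have hcmd : ¬ Wd.HasCM := twin_not_hasCM W hcm hd Wd hWd
  have hrtw : (W.quadraticTwist (NumberField.discr K : ℚ)).analyticRank = 1 := by
    obtain ⟨C, hC⟩ := hWd
    rw [← analyticRank_smul (W.quadraticTwist (NumberField.discr K : ℚ)) C, hC]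
    exact hrd
  -- B = Gross–Zagier + entire `L`
  have hy : ¬ IsOfFinAddOrder d₁.derivedPoint :=
    stub_heegnerNonTorsionAtTwo_of_published hE hGZ W K hIQ hHe hr0 hrtw Dt β ι d₁
  obtain ⟨M₀, hdiv, hndiv⟩ := exists_exactTwoDivisibility_of_not_isOfFinAddOrder W hIQ Dt β ι d₁ hy
  -- C = U through the intrinsic dictionary
  obtain ⟨n, d, hn, hKoly, hPn⟩ := exists_derivedPoint_not_two_dvd_of_multiGenusTrace hIQ hodd h3 hHe
    (hU W hcm hr0 hρ hT K hIQ hodd h3 hHe hsq1 hsq2 Dt hoptDt hc β ι d₁ hy Wd hWd hrd hSel)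
  exact ⟨K, iF, iN, hIQ, hodd, h3, hHe, hsq1, hsq2, Dt, β, ι, d₁, hoptDt, hc, hy, M₀, hdiv, hndiv, n, d, hn, hKoly, hPn,
    Wd, iE, iM, hWd, hcmd, hrd, hSel⟩

open scoped AddSubgroup

/-- **R-128 retype** (director-bsd 2026-08-29, T-Q381-1′) of `genusPrimitiveSupplyAtTwo_of_twoConverse_of_multiGenus`: the SAME statement and proof with the `2`-parity hypothesis in PRINT form `∀ (V : WeierstrassCurve ℚ) [V.IsElliptic], p_parity V 2` (Dokchitser–Dokchitser 2010 Thm. 1.4 is about elliptic curves; the bare closure over all Weierstrass cubics was off print). **THE CRUX `GenusPrimitiveSupplyAtTwo` BY NAME, MODULO PRINT ∧ (CONV₂) ∧ (U).** PRINT inputs: Modularity `exists_isNewformOf`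
(BCDT 2001), the `2`-parity theorem `p_parity · 2` (Dokchitser–Dokchitser 2010 ∕ Monsky), the Cassels–Tate pairing
`exists_casselsTate_pairing` (Cassels 1962), the Mazur–Rubin lowering step `hMR` (Mazur–Rubin 2010 Prop. 5.2 in proof form over
`ℚ`, spelled out as by gk2-p5's `minimalSelmerTwinSupply_of_lowering'`), and the Gross–Zagier formula `gross_zagier` (gk2-p4's
`stub_heegnerNonTorsionAtTwo_of_grossZagier` discharged the modularity binder of stub B). The two NON-print hypotheses are the
line's open kernels: (CONV₂) the rank-one `2`-converse for non-CM curves (crux 19220 of route `TwoAdicConverse`), and (U) «on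
the habitat some multi-genus Heegner trace `Tr_{K[n]/K(√ℓ₁*,…,√ℓ_r*)} y(n)` is not `2`-divisible in `E(K[n])`» (Birch's lemma at
`2` for full-`2`-image curves ∕ Kolyvagin's conjecture mod `2`; in the binder frame of stub C). CONDITIONAL; crux 22136 is OPEN
exactly at (CONV₂) ∧ (U). BSD is not proved by any of this. [cite: MazurRubin2010, Prop. 5.2 (proof) with Lemma 3.6]
[cite: GrossZagier1986, Thm. I.6.3] [cite: DokchitserDokchitserAnnals2010, Thm. 1.4] [cite: GrossLMS1991, §3 (3.5), §4 (4.1)] -/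
theorem genusPrimitiveSupplyAtTwo_of_twoConverse_of_multiGenus' (hmod : exists_isNewformOf)
    (hpar : ∀ (V : WeierstrassCurve ℚ) [V.IsElliptic], p_parity V 2) (hCT : exists_casselsTate_pairing (K := ℚ))
    (hMR : ∀ (V : WeierstrassCurve ℚ) [V.IsElliptic], Nat.card (V.toAffine.Point[((2 : ℕ) : ℤ)]) = 1 →
      ∀ s : ℕ, Nat.card (V.selmerGroup 2) = 2 ^ s → 1 < s → ∀ m : ℕ, m ≠ 0 →
        ∃ p : ℕ, p.Prime ∧ (p : ℤ) ≡ 1 [ZMOD (m : ℤ)] ∧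
          Nat.card ((V.quadraticTwist (p : ℚ)).selmerGroup 2) = 2 ^ (s - 2))
    (hGZ : ∀ (W : WeierstrassCurve ℚ) [NeZero (W.conductorNorm ℤ)] (K : Type) [Field K] [NumberField K],
      gross_zagier (W.conductorNorm ℤ) W K)
    (hconv : ∀ (V : WeierstrassCurve ℚ) [V.IsElliptic] [V.IsGloballyMinimal],
      ¬ V.HasCM → V.selmerCorank 2 = 1 → V.analyticRank = 1)
    (hU : ∀ (W : WeierstrassCurve ℚ) [W.IsElliptic] [W.IsGloballyMinimal] [NeZero (W.conductorNorm ℤ)],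
      ¬ W.HasCM → W.analyticRank = 0 → (∀ n : ℕ, 0 < n → W.HasSurjectiveModNGaloisRep ((2 : ℤ) ^ n)) →
      Odd W.tamagawaProduct →
      ∀ (K : Type) [Field K] [NumberField K],
      IsImaginaryQuadratic K → Odd (NumberField.discr K) → NumberField.discr K ≠ -3 →
      SatisfiesHeegnerHypothesis (W.conductorNorm ℤ) K →
      ¬ IsSquare ((NumberField.discr K : ℚ) * -|W.Δ|) → ¬ IsSquare ((NumberField.discr K : ℚ) * (-(2 * |W.Δ|))) →
      ∀ (Dt : ModularParametrizationData W (W.conductorNorm ℤ)),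
      (∀ z ∈ Dt.L.lattice, ∃ w ∈ periodLattice Dt.f, z = (Dt.c : ℂ) * w) → Odd Dt.c →
      ∀ (β : ℤ) (ι : K →+* ℂ) (d₁ : KolyvaginHeegnerData Dt β ι 1), ¬ IsOfFinAddOrder d₁.derivedPoint →
      ∀ (Wd : WeierstrassCurve ℚ) [Wd.IsElliptic] [Wd.IsGloballyMinimal],
      (∃ C : WeierstrassCurve.VariableChange ℚ, C • W.quadraticTwist (NumberField.discr K : ℚ) = Wd) →
      Wd.analyticRank = 1 → Nat.card (Wd.selmerGroup 2) = 2 →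
      ∃ (n : ℕ) (d : KolyvaginHeegnerData Dt β ι n) (θ : ℕ → ringClassField K ι n)
        (T : Finset (ringClassField K ι n ≃ₐ[ℚ] ringClassField K ι n)), Squarefree n ∧
        (∀ ℓ ∈ n.primeFactors, Zhang2014.IsKolyvaginPrime (W.conductorNorm ℤ) W K 2 ℓ) ∧
        (∀ ℓ ∈ n.primeFactors, θ ℓ ^ 2 = algebraMap ℚ (ringClassField K ι n) ((-1 : ℚ) ^ (ℓ / 2) * ℓ)) ∧
        (∀ g, g ∈ T ↔ g ∈ ringClassGal ι n ∧ ∀ ℓ ∈ n.primeFactors, g (θ ℓ) = θ ℓ) ∧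
        ¬ ∃ Q : (W.baseChange (ringClassField K ι n)).toAffine.Point, (2 : ℤ) • Q =
          ∑ g ∈ T, pointGalHom W (ringClassField K ι n) g d.y) :
    Summit.BirchSwinnertonDyer.BirchSwinnertonDyer.Theses.GenusKolyvaginAtTwo.GenusPrimitiveSupplyAtTwo := by
  intro W _ _ _ hcm hr0 hρ hT hopt
  -- A = MR-lowering SUPPLY + CONV₂
  obtain ⟨K, iF, iN, hIQ, hodd, h3, hHe, hsq1, hsq2, Wd, iE, iM, hWd, hrd, hSel⟩ :=
    stub_minimalTwinSupplyAtTwo_of_lowering_of_twoConverse' hmod hpar hCT hMR hconv W hcm hr0 hρ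
  obtain ⟨Dt, hoptDt, hc⟩ := hopt
  obtain ⟨β, hβ⟩ : ∃ β : ℤ, (4 * (W.conductorNorm ℤ : ℕ) : ℤ) ∣ β ^ 2 - NumberField.discr K :=
    Literature.NumberTheory.QuadraticFields.Quadratic.exists_dvd_sq_sub_discr_of_ncard_primesOver hIQ.1 (NeZero.ne _) hHe
  obtain ⟨ι⟩ : Nonempty (K →+* ℂ) := inferInstance
  obtain ⟨d₁⟩ := exists_kolyvaginHeegnerData_one
    (phi_heegnerTau_mem_singularModuliField_holds (W.conductorNorm ℤ) W K) hIQ Dt β ι hβ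
  have hd : (NumberField.discr K : ℚ) ≠ 0 := by exact_mod_cast NumberField.discr_ne_zero K
  haveI := W.isElliptic_quadraticTwist hd
  have hcmd : ¬ Wd.HasCM := twin_not_hasCM W hcm hd Wd hWd
  have hrtw : (W.quadraticTwist (NumberField.discr K : ℚ)).analyticRank = 1 := by
    obtain ⟨C, hC⟩ := hWd
    rw [← analyticRank_smul (W.quadraticTwist (NumberField.discr K : ℚ)) C, hC]
    exact hrd
  -- B = Gross–Zagier alone
  have hy : ¬ IsOfFinAddOrder d₁.derivedPoint := stub_heegnerNonTorsionAtTwo_of_grossZagier hGZ W K hIQ hHe hr0 hrtw Dt β ι d₁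
  obtain ⟨M₀, hdiv, hndiv⟩ := exists_exactTwoDivisibility_of_not_isOfFinAddOrder W hIQ Dt β ι d₁ hy
  -- C = U through the intrinsic dictionary
  obtain ⟨n, d, hn, hKoly, hPn⟩ := exists_derivedPoint_not_two_dvd_of_multiGenusTrace hIQ hodd h3 hHe
    (hU W hcm hr0 hρ hT K hIQ hodd h3 hHe hsq1 hsq2 Dt hoptDt hc β ι d₁ hy Wd hWd hrd hSel)
  exact ⟨K, iF, iN, hIQ, hodd, h3, hHe, hsq1, hsq2, Dt, β, ι, d₁, hoptDt, hc, hy, M₀, hdiv, hndiv, n, d, hn, hKoly, hPn,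
    Wd, iE, iM, hWd, hcmd, hrd, hSel⟩


/-- **R-128 retype** (director-bsd 2026-08-29, T-Q381-1′) of `genusPrimitiveSupplyAtTwo_of_namedFacts_of_twoConverse_of_multiGenus`: the SAME statement and proof with the `2`-parity hypothesis in PRINT form `∀ (V : WeierstrassCurve ℚ) [V.IsElliptic], p_parity V 2` (Dokchitser–Dokchitser 2010 Thm. 1.4 is about elliptic curves; the bare closure over all Weierstrass cubics was off print). **THE CRUX `GenusPrimitiveSupplyAtTwo` BY NAME, MODULO FIVE NAMED PRINT FACTS ∧ (CONV₂) ∧ (U).** The named facts: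
`exists_isNewformOf` (BCDT 2001), `p_parity · 2` (Dokchitser–Dokchitser 2010), `exists_casselsTate_pairing` (Cassels 1962),
`MazurRubin2010.prop52_rat` (Mazur–Rubin 2010 Prop. 5.2 over `ℚ`, proof form), `gross_zagier` (Gross–Zagier 1986 Thm. I.6.3).
The two remaining binders are the line's open kernels (CONV₂) — the rank-one `2`-converse for non-CM curves, crux 19220 of route
`TwoAdicConverse` widened off its reduction clause — and (U) — multi-genus `2`-primitivity on the habitat, in the frame of stub C.
This is `genusPrimitiveSupplyAtTwo_of_twoConverse_of_multiGenus'` with `hMR := prop52_rat`. CONDITIONAL; crux 22136 is OPEN exactly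
at (CONV₂) ∧ (U). BSD is not proved by any of this. [cite: MazurRubin2010, Prop. 5.2 (proof) with Lemma 3.6]
[cite: GrossZagier1986, Thm. I.6.3] [cite: DokchitserDokchitserAnnals2010, Thm. 1.4] [cite: GrossLMS1991, §3 (3.5), §4 (4.1)] -/
theorem genusPrimitiveSupplyAtTwo_of_namedFacts_of_twoConverse_of_multiGenus' (hmod : exists_isNewformOf)
    (hpar : ∀ (V : WeierstrassCurve ℚ) [V.IsElliptic], p_parity V 2) (hCT : exists_casselsTate_pairing (K := ℚ))
    (hMR : Literature.NumberTheory.EllipticCurves.MazurRubin2010.prop52_rat)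
    (hGZ : ∀ (W : WeierstrassCurve ℚ) [NeZero (W.conductorNorm ℤ)] (K : Type) [Field K] [NumberField K],
      gross_zagier (W.conductorNorm ℤ) W K)
    (hconv : ∀ (V : WeierstrassCurve ℚ) [V.IsElliptic] [V.IsGloballyMinimal],
      ¬ V.HasCM → V.selmerCorank 2 = 1 → V.analyticRank = 1)
    (hU : ∀ (W : WeierstrassCurve ℚ) [W.IsElliptic] [W.IsGloballyMinimal] [NeZero (W.conductorNorm ℤ)],
      ¬ W.HasCM → W.analyticRank = 0 → (∀ n : ℕ, 0 < n → W.HasSurjectiveModNGaloisRep ((2 : ℤ) ^ n)) →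
      Odd W.tamagawaProduct →
      ∀ (K : Type) [Field K] [NumberField K],
      IsImaginaryQuadratic K → Odd (NumberField.discr K) → NumberField.discr K ≠ -3 →
      SatisfiesHeegnerHypothesis (W.conductorNorm ℤ) K →
      ¬ IsSquare ((NumberField.discr K : ℚ) * -|W.Δ|) → ¬ IsSquare ((NumberField.discr K : ℚ) * (-(2 * |W.Δ|))) →
      ∀ (Dt : ModularParametrizationData W (W.conductorNorm ℤ)),
      (∀ z ∈ Dt.L.lattice, ∃ w ∈ periodLattice Dt.f, z = (Dt.c : ℂ) * w) → Odd Dt.c →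
      ∀ (β : ℤ) (ι : K →+* ℂ) (d₁ : KolyvaginHeegnerData Dt β ι 1), ¬ IsOfFinAddOrder d₁.derivedPoint →
      ∀ (Wd : WeierstrassCurve ℚ) [Wd.IsElliptic] [Wd.IsGloballyMinimal],
      (∃ C : WeierstrassCurve.VariableChange ℚ, C • W.quadraticTwist (NumberField.discr K : ℚ) = Wd) →
      Wd.analyticRank = 1 → Nat.card (Wd.selmerGroup 2) = 2 →
      ∃ (n : ℕ) (d : KolyvaginHeegnerData Dt β ι n) (θ : ℕ → ringClassField K ι n)
        (T : Finset (ringClassField K ι n ≃ₐ[ℚ] ringClassField K ι n)), Squarefree n ∧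
        (∀ ℓ ∈ n.primeFactors, Zhang2014.IsKolyvaginPrime (W.conductorNorm ℤ) W K 2 ℓ) ∧
        (∀ ℓ ∈ n.primeFactors, θ ℓ ^ 2 = algebraMap ℚ (ringClassField K ι n) ((-1 : ℚ) ^ (ℓ / 2) * ℓ)) ∧
        (∀ g, g ∈ T ↔ g ∈ ringClassGal ι n ∧ ∀ ℓ ∈ n.primeFactors, g (θ ℓ) = θ ℓ) ∧
        ¬ ∃ Q : (W.baseChange (ringClassField K ι n)).toAffine.Point, (2 : ℤ) • Q =
          ∑ g ∈ T, pointGalHom W (ringClassField K ι n) g d.y) :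
    Summit.BirchSwinnertonDyer.BirchSwinnertonDyer.Theses.GenusKolyvaginAtTwo.GenusPrimitiveSupplyAtTwo :=
  genusPrimitiveSupplyAtTwo_of_twoConverse_of_multiGenus' hmod hpar hCT hMR hGZ hconv hU

/-! ## R-128 retype — APPEND (seat bsd-line-gk2-p2 g21, 2026-08-30): the print-form twin of
`…OfExactComponent.genusPrimitiveSupplyAtTwo_of_namedFacts_of_twoConverse_of_exactGenusComponent` is placed HERE (same namespace,
`…OfExactComponent` imported) rather than appended to its own file, so that this module is re-committed and its hub olean rebuilt
(the first commit of this file, p748251, never received an olean — farm `incoherent:…OfKernelsEll` —, which blocked every importer).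
BSD is NOT proved by any of this. -/

/-- **R-128 retype** (director-bsd 2026-08-29, T-Q381-1′) of `genusPrimitiveSupplyAtTwo_of_namedFacts_of_twoConverse_of_exactGenusComponent`: the SAME statement and proof with the `2`-parity hypothesis in PRINT form `∀ (V : WeierstrassCurve ℚ) [V.IsElliptic], p_parity V 2` (Dokchitser–Dokchitser 2010 Thm. 1.4 is about elliptic curves; the bare closure over all Weierstrass cubics was off print). **THE CRUX BY NAME FROM PRINT ∧ (CONV₂) ∧ SUPPLY ∧ (X) «EXACT GENUS COMPONENT».** Named print facts `exists_isNewformOf` (BCDT),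
`p_parity · 2` (Dokchitser–Dokchitser), `exists_casselsTate_pairing` (Cassels), `MazurRubin2010.prop52_rat` (Mazur–Rubin 2010 Prop. 5.2),
`gross_zagier` (Gross–Zagier); (CONV₂) the rank-one `2`-converse for non-CM curves (= crux 19220 widened) — OPEN; (X) in binder form:
on the habitat, for every admissible frame, some square-free `n` of Kolyvagin primes at `2`, radicals `θ`, an enumeration `G` of
`Gal(K[n]/K)` and some `M₀ ⊆ {ℓ∣n}` with all genus-character components `Y_M` (`M ≠ M₀`) in `2^{r+1}E(K[n])` and `Y_{M₀} ∉ 2^{r+1}E(K[n])`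
— OPEN (an exact `2`-adic Heegner-index statement for one genus twist `E^{(m₀*)}/K`; W. Zhang's theorem at `p = 2` in genus form).
CONDITIONAL; nothing is closed. [cite: GrossLMS1991, §3 (3.5), Prop. 3.7 (1), §4 (4.1)] [cite: GrossZagier1986, Thm. I.6.3]
[cite: DokchitserDokchitserAnnals2010, Thm. 1.4] [cite: MazurRubin2010, Prop. 5.2] [cite: McCallumLMS1991, §5] -/
theorem genusPrimitiveSupplyAtTwo_of_namedFacts_of_twoConverse_of_exactGenusComponent' (hmod : exists_isNewformOf)
    (hpar : ∀ (V : WeierstrassCurve ℚ) [V.IsElliptic], p_parity V 2) (hCT : exists_casselsTate_pairing (K := ℚ))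
    (hMR : Literature.NumberTheory.EllipticCurves.MazurRubin2010.prop52_rat)
    (hGZ : ∀ (W : WeierstrassCurve ℚ) [NeZero (W.conductorNorm ℤ)] (K : Type) [Field K] [NumberField K],
      gross_zagier (W.conductorNorm ℤ) W K)
    (hconv : ∀ (V : WeierstrassCurve ℚ) [V.IsElliptic] [V.IsGloballyMinimal],
      ¬ V.HasCM → V.selmerCorank 2 = 1 → V.analyticRank = 1)
    (hX : ∀ (W : WeierstrassCurve ℚ) [W.IsElliptic] [W.IsGloballyMinimal] [NeZero (W.conductorNorm ℤ)],
      ¬ W.HasCM → W.analyticRank = 0 → (∀ n : ℕ, 0 < n → W.HasSurjectiveModNGaloisRep ((2 : ℤ) ^ n)) →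
      Odd W.tamagawaProduct →
      ∀ (K : Type) [Field K] [NumberField K],
      IsImaginaryQuadratic K → Odd (NumberField.discr K) → NumberField.discr K ≠ -3 →
      SatisfiesHeegnerHypothesis (W.conductorNorm ℤ) K →
      ¬ IsSquare ((NumberField.discr K : ℚ) * -|W.Δ|) → ¬ IsSquare ((NumberField.discr K : ℚ) * (-(2 * |W.Δ|))) →
      ∀ (Dt : ModularParametrizationData W (W.conductorNorm ℤ)),
      (∀ z ∈ Dt.L.lattice, ∃ w ∈ periodLattice Dt.f, z = (Dt.c : ℂ) * w) → Odd Dt.c →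
      ∀ (β : ℤ) (ι : K →+* ℂ) (d₁ : KolyvaginHeegnerData Dt β ι 1), ¬ IsOfFinAddOrder d₁.derivedPoint →
      ∀ (Wd : WeierstrassCurve ℚ) [Wd.IsElliptic] [Wd.IsGloballyMinimal],
      (∃ C : WeierstrassCurve.VariableChange ℚ, C • W.quadraticTwist (NumberField.discr K : ℚ) = Wd) →
      Wd.analyticRank = 1 → Nat.card (Wd.selmerGroup 2) = 2 →
      ∃ (n : ℕ) (d : KolyvaginHeegnerData Dt β ι n) (θ : ℕ → ringClassField K ι n)
        (G : Finset (ringClassField K ι n ≃ₐ[ℚ] ringClassField K ι n)) (M₀ : Finset ℕ), Squarefree n ∧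
        (∀ ℓ ∈ n.primeFactors, Zhang2014.IsKolyvaginPrime (W.conductorNorm ℤ) W K 2 ℓ) ∧
        (∀ ℓ ∈ n.primeFactors, θ ℓ ^ 2 = algebraMap ℚ (ringClassField K ι n) ((-1 : ℚ) ^ (ℓ / 2) * ℓ)) ∧
        (∀ g, g ∈ G ↔ g ∈ ringClassGal ι n) ∧ M₀ ∈ n.primeFactors.powerset ∧
        (∀ M ∈ n.primeFactors.powerset, M ≠ M₀ → ∃ Q : (W.baseChange (ringClassField K ι n)).toAffine.Point,
          ((2 : ℤ) ^ (n.primeFactors.card + 1)) • Q =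
            ∑ g ∈ G, (∏ ℓ ∈ M, (if g (θ ℓ) = θ ℓ then (1 : ℤ) else -1)) • pointGalHom W (ringClassField K ι n) g d.y) ∧
        ¬ ∃ Q : (W.baseChange (ringClassField K ι n)).toAffine.Point, ((2 : ℤ) ^ (n.primeFactors.card + 1)) • Q =
          ∑ g ∈ G, (∏ ℓ ∈ M₀, (if g (θ ℓ) = θ ℓ then (1 : ℤ) else -1)) • pointGalHom W (ringClassField K ι n) g d.y) :
    Summit.BirchSwinnertonDyer.BirchSwinnertonDyer.Theses.GenusKolyvaginAtTwo.GenusPrimitiveSupplyAtTwo := by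
  refine genusPrimitiveSupplyAtTwo_of_namedFacts_of_twoConverse_of_multiGenus' hmod hpar hCT hMR hGZ hconv ?_
  intro W _ _ _ hcm hr0 hρ hT K _ _ hIQ hodd h3 hHe hsq1 hsq2 Dt hoptDt hc β ι d₁ hy Wd _ _ hWd hrd hSel
  obtain ⟨n, d, θ, G, M₀, hn, hKoly, hθ, hG, hM₀, hdeep, hexact⟩ :=
    hX W hcm hr0 hρ hT K hIQ hodd h3 hHe hsq1 hsq2 Dt hoptDt hc β ι d₁ hy Wd hWd hrd hSel
  refine ⟨n, d, θ, G.filter (fun g ↦ ∀ ℓ ∈ n.primeFactors, g (θ ℓ) = θ ℓ), hn, hKoly, hθ,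
    fun g ↦ by rw [Finset.mem_filter, hG], ?_⟩
  exact heegner_not_exists_two_zsmul_eq_multiGenusTrace_of_exactComponent hIQ hodd hHe (by simpa using hρ 1 one_pos)
    hn.ne_zero d θ G hG _ (fun g ↦ by rw [Finset.mem_filter, hG]) hM₀ hdeep hexact

end Summit.BirchSwinnertonDyer.BirchSwinnertonDyer.Theorems.GenusKoly

end
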